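import Literature.NumberTheory.GaloisCohomology.PoitouTateRealCorrection
import Literature.NumberTheory.GaloisCohomology.PoitouTatePrimePowerRealVanishing
import Literature.NumberTheory.GaloisCohomology.PoitouTateOddLevelRealPlaces
import HarnessLib

/-!
# Poitou–Tate `∑_v inv_v = 0` for EVERY number field: `poitouTate_sum_localTatePairing_eq_zero_holds`

Tate's reciprocity law for the Brauer group — the local invariants of a global class of
`H²(Γ_K, μₙ) = Br(K)[n]` sum to zero (Cassels–Fröhlich VII §9.6/§11; Milne, *ADT* I Thm. 4.10 (b);
Albert–Brauer–Hasse–Noether) — for THE invariant maps `LocalInvariants.canonical K n` of an ARBITRARY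
number field `K` and every level `n ≥ 1`, and with it the tree's named fact
`poitouTate_sum_localTatePairing_eq_zero K` (`PoitouTate.lean`, D-0014) for every `K : Type`:

* `exists_realCorrection` — at an even level, every class agrees at the real places with a class whose
  invariants are finitely supported and sum to zero (sum of the one-place corrections
  `exists_realCorrection_single`, by induction on the bad real places);
* `sumInvLocalizationEqZero_canonical_primePow_of_numberField` — prime-power levels: subtract the real
  correction (`p = 2`; nothing to do for `p` odd, `archimedeanInvariantMap_eq_zero_of_odd`) and apply
  the finite-place law for real-vanishing classes
  (`sum_localInvariantMap_localization_eq_zero_of_forall_isReal`);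
* `sumInvLocalizationEqZero_canonical_of_numberField` — all levels (primary reduction
  `sumInvLocalizationEqZero_canonical_of_primePow_of_numberField`);
* **`poitouTate_sum_localTatePairing_eq_zero_holds`** — the named fact, every number field `K : Type`
  (`poitouTate_sum_localTatePairing_eq_zero_of_canonical`).

This closes the `∀ K` form of the (F1) campaign of cell `bsd-cn100` (seats transfer-2 g4/g5, ty g5/g6,
s2b-c3 g4): the earlier tree theorems covered `K` totally complex (`PoitouTateSumTotallyComplex`) and
odd levels (`PoitouTateOddLevels`).  Theorems only (D-0026).  HONEST FRAMING: textbook class field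
theory (Tate 1967); proves no case of BSD, but removes the hypothesis `(hPT : poitouTate_sum_… K)` from
every consumer over a number field `K : Type` (e.g. `K = ℚ`).

## References

* J. Tate, *Global class field theory*, Ch. VII of Cassels–Fröhlich (1967), §9.6, §10, §11. [CasselsFrohlichANT1967]
* J. S. Milne, *Arithmetic Duality Theorems*, 2nd ed. (2006), Ch. I Thm. 4.10 (b). [MilneADT2006]
* D. Harari, *Galois Cohomology and Class Field Theory* (2020), Thm. 14.11. [Harari2020]
-/

noncomputable section

open CategoryTheory Function Field NumberField IsDedekindDomain
open scoped NumberField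

namespace Literature.NumberTheory.GaloisCohomology

open _root_.ContinuousCohomology
open Literature.NumberTheory.GaloisRepresentations
open Literature.NumberTheory.GaloisRepresentations.DiscreteGaloisModule

variable (K : Type) [Field K] [NumberField K]

/-- The only element of order dividing `2` other than `0` in `ℤ/n` is `n/2`. [folklore] -/
private theorem zmod_eq_natCast_div_two {n : ℕ} [NeZero n] (x : ZMod n) (h2 : 2 • x = 0) (h0 : x ≠ 0) :
    x = ((n / 2 : ℕ) : ZMod n) := by
  have hlt : x.val < n := ZMod.val_lt x
  have hpos : 0 < x.val := Nat.pos_of_ne_zero fun h => h0 ((ZMod.val_eq_zero x).mp h)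
  have h2' : ((2 * x.val : ℕ) : ZMod n) = 0 := by
    rw [two_mul, Nat.cast_add, ZMod.natCast_zmod_val, ← two_nsmul]
    exact h2
  obtain ⟨k, hk⟩ := (ZMod.natCast_eq_zero_iff _ _).mp h2'
  have hk1 : k = 1 := by
    rcases Nat.lt_or_ge k 2 with hk2 | hk2
    · interval_cases k
      · omega
      · rfl
    · have : n * 2 ≤ n * k := Nat.mul_le_mul_left n hk2
      omega
  subst hk1
  rw [mul_one] at hk
  have hv : x.val = n / 2 := by omega
  rw [← hv, ZMod.natCast_zmod_val]

/-! ### §1. The correction at the real places (even levels) -/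

/-- **Correction at the real places** (even level `n`): every class `c ∈ H²(Γ_K, μₙ)` agrees AT EVERY
REAL PLACE with a class `cinf` whose local invariants are supported in a finite set of places and sum to
zero over every larger finite set — the sum of the one-place corrections `exists_realCorrection_single`
at the real places where `c` does not vanish (induction on a finite set containing them).
[cite: CasselsFrohlichANT1967, Ch. VII §11] -/
theorem exists_realCorrection {n : ℕ} [NeZero n] (h2n : 2 ∣ n) (c : galoisCohomology (mu K n) 2) :
    haveI : CompactSpace (absoluteGaloisGroup K) := absoluteGaloisGroup_compactSpace K
    ∃ c' : galoisCohomology (mu K n) 2,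
      (∀ w : InfinitePlace K, w.IsReal →
        haveI : CompactSpace (absoluteGaloisGroup (Place.Completion (K := K) (Sum.inl w))) :=
          absoluteGaloisGroup_compactSpace _
        galoisCohomology.localization (mu K n) (Sum.inl w) 2 c' =
          galoisCohomology.localization (mu K n) (Sum.inl w) 2 c) ∧
      ∃ S₀ : Finset (Place K),
        (∀ v ∉ S₀, LocalInvariants.canonical K n v (galoisCohomology.localization (mu K n) v 2 c') = 0) ∧
        ∀ T : Finset (Place K), S₀ ⊆ T →
          ∑ v ∈ T, LocalInvariants.canonical K n v (galoisCohomology.localization (mu K n) v 2 c') = 0 := by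
  classical
  haveI : CompactSpace (absoluteGaloisGroup K) := absoluteGaloisGroup_compactSpace K
  -- induction on a finite set of infinite places off which `c` vanishes at the real places
  suffices main : ∀ (F : Finset (InfinitePlace K)) (c : galoisCohomology (mu K n) 2),
      (∀ w : InfinitePlace K, w.IsReal → w ∉ F →
        haveI : CompactSpace (absoluteGaloisGroup (Place.Completion (K := K) (Sum.inl w))) :=
          absoluteGaloisGroup_compactSpace _
        galoisCohomology.localization (mu K n) (Sum.inl w) 2 c = 0) →
      ∃ c' : galoisCohomology (mu K n) 2,
        (∀ w : InfinitePlace K, w.IsReal →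
          haveI : CompactSpace (absoluteGaloisGroup (Place.Completion (K := K) (Sum.inl w))) :=
            absoluteGaloisGroup_compactSpace _
          galoisCohomology.localization (mu K n) (Sum.inl w) 2 c' =
            galoisCohomology.localization (mu K n) (Sum.inl w) 2 c) ∧
        ∃ S₀ : Finset (Place K),
          (∀ v ∉ S₀, LocalInvariants.canonical K n v (galoisCohomology.localization (mu K n) v 2 c') = 0) ∧
          ∀ T : Finset (Place K), S₀ ⊆ T →
            ∑ v ∈ T, LocalInvariants.canonical K n v (galoisCohomology.localization (mu K n) v 2 c') = 0 by
    exact main Finset.univ c fun w _ hw => absurd (Finset.mem_univ w) hw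
  intro F
  induction F using Finset.induction_on with
  | empty =>
    intro c hc
    refine ⟨0, fun w hw => ?_, ∅, fun v _ => by rw [map_zero, map_zero], fun T _ => ?_⟩
    · rw [map_zero, hc w hw (Finset.notMem_empty w)]
    · exact Finset.sum_eq_zero fun v _ => by rw [map_zero, map_zero]
  | insert w₀ F hw₀F ih =>
    intro c hc
    -- if `c` already vanishes at `w₀` (or `w₀` is complex), the induction hypothesis applies directly
    by_cases hgood : ∀ hw₀ : w₀.IsReal,
        haveI : CompactSpace (absoluteGaloisGroup (Place.Completion (K := K) (Sum.inl w₀))) :=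
          absoluteGaloisGroup_compactSpace _
        galoisCohomology.localization (mu K n) (Sum.inl w₀) 2 c = 0
    · refine ih c fun w hw hwF => ?_
      by_cases hww : w = w₀
      · subst hww; exact hgood hw
      · exact hc w hw (by rw [Finset.mem_insert, not_or]; exact ⟨hww, hwF⟩)
    push Not at hgood
    obtain ⟨hw₀, hc₀⟩ := hgood
    haveI : CompactSpace (absoluteGaloisGroup (Place.Completion (K := K) (Sum.inl w₀))) :=
      absoluteGaloisGroup_compactSpace _
    -- the one-place correction at `w₀`
    obtain ⟨x, hx₀, hx, S₀, hS₀, hrec₀⟩ := exists_realCorrection_single K h2n hw₀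
    -- `loc_{w₀} x = loc_{w₀} c`: both have invariant `n/2`
    have hinvc : archimedeanInvariantMap K n w₀ (galoisCohomology.localization (mu K n) (Sum.inl w₀) 2 c) =
        ((n / 2 : ℕ) : ZMod n) := by
      refine zmod_eq_natCast_div_two _ (two_nsmul_archimedeanInvariantMap _) fun h0 => hc₀ ?_
      exact archimedeanInvariantMap_injective_of_isReal hw₀ (by rw [h0, map_zero])
    have hxc : galoisCohomology.localization (mu K n) (Sum.inl w₀) 2 x =
        galoisCohomology.localization (mu K n) (Sum.inl w₀) 2 c :=
      archimedeanInvariantMap_injective_of_isReal hw₀ (by rw [hx₀, hinvc])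
    -- `c - x` vanishes at the real places off `F`
    obtain ⟨c₁, hc₁, S₁, hS₁, hrec₁⟩ := ih (c - x) fun w hw hwF => by
      haveI : CompactSpace (absoluteGaloisGroup (Place.Completion (K := K) (Sum.inl w))) :=
        absoluteGaloisGroup_compactSpace _
      by_cases hww : w = w₀
      · subst hww
        rw [map_sub, hxc, sub_self]
      · rw [map_sub, hx w hw hww, sub_zero]
        exact hc w hw (by rw [Finset.mem_insert, not_or]; exact ⟨hww, hwF⟩)
    refine ⟨c₁ + x, fun w hw => ?_, S₁ ∪ S₀, fun v hv => ?_, fun T hT => ?_⟩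
    · rw [map_add, hc₁ w hw, map_sub, sub_add_cancel]
    · rw [Finset.notMem_union] at hv
      rw [map_add, map_add, hS₁ v hv.1, hS₀ v hv.2, add_zero]
    · rw [Finset.sum_congr rfl fun v _ => by rw [map_add, map_add], Finset.sum_add_distrib,
        hrec₁ T (Finset.union_subset_left hT), hrec₀ T (Finset.union_subset_right hT), add_zero]

/-! ### §2. Prime-power levels, every number field -/

/-- **`(LocalInvariants.canonical K (p^(m+1))).SumInvLocalizationEqZero` for EVERY number field `K` and
every prime `p`** (Tate's reciprocity law `∑_v inv_v = 0` on `H²(Γ_K, μ_{p^{m+1}})`): subtract from the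
given class a class with the same real localisations whose invariants sum to zero
(`exists_realCorrection`, `p = 2`; for `p` odd the real localisations vanish,
`archimedeanInvariantMap_eq_zero_of_odd`), and apply the finite-place law for classes vanishing at the
real places (`sum_localInvariantMap_localization_eq_zero_of_forall_isReal`); the complex places
contribute nothing. [cite: CasselsFrohlichANT1967, Ch. VII §11] [cite: MilneADT2006, Ch. I, Thm. 4.10(b)] -/
theorem sumInvLocalizationEqZero_canonical_primePow_of_numberField (p : ℕ) [hp : Fact p.Prime] (m : ℕ) :
    (LocalInvariants.canonical K (p ^ (m + 1))).SumInvLocalizationEqZero := by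
  classical
  haveI : CompactSpace (absoluteGaloisGroup K) := absoluteGaloisGroup_compactSpace K
  intro c S hS
  -- a class `cinf` with the same real localisations and vanishing invariant sums
  obtain ⟨cinf, hinfw, Sinf, hsupp, hrec⟩ : ∃ cinf : galoisCohomology (mu K (p ^ (m + 1))) 2,
      (∀ w : InfinitePlace K, w.IsReal →
        haveI : CompactSpace (absoluteGaloisGroup (Place.Completion (K := K) (Sum.inl w))) :=
          absoluteGaloisGroup_compactSpace _
        galoisCohomology.localization (mu K (p ^ (m + 1))) (Sum.inl w) 2 cinf =
          galoisCohomology.localization (mu K (p ^ (m + 1))) (Sum.inl w) 2 c) ∧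
      ∃ S₀ : Finset (Place K),
        (∀ v ∉ S₀, LocalInvariants.canonical K (p ^ (m + 1)) v
          (galoisCohomology.localization (mu K (p ^ (m + 1))) v 2 cinf) = 0) ∧
        ∀ T : Finset (Place K), S₀ ⊆ T →
          ∑ v ∈ T, LocalInvariants.canonical K (p ^ (m + 1)) v
            (galoisCohomology.localization (mu K (p ^ (m + 1))) v 2 cinf) = 0 := by
    by_cases hp2 : p = 2
    · refine exists_realCorrection K ?_ c
      rw [hp2]
      exact dvd_pow_self 2 (Nat.succ_ne_zero m)
    · have hodd : Odd (p ^ (m + 1)) := (hp.out.odd_of_ne_two hp2).pow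
      refine ⟨0, fun w hw => ?_, ∅, fun v _ => by rw [map_zero, map_zero],
        fun T _ => Finset.sum_eq_zero fun v _ => by rw [map_zero, map_zero]⟩
      haveI : CompactSpace (absoluteGaloisGroup (Place.Completion (K := K) (Sum.inl w))) :=
        absoluteGaloisGroup_compactSpace _
      rw [map_zero]
      symm
      exact archimedeanInvariantMap_injective_of_isReal hw
        (by rw [map_zero, archimedeanInvariantMap_eq_zero_of_odd hodd w])
  -- the corrected class vanishes at the real places
  set c₁ := c - cinf with hc₁
  have hreal₁ : ∀ w : InfinitePlace K, w.IsReal →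
      haveI : CompactSpace (absoluteGaloisGroup (Place.Completion (K := K) (Sum.inl w))) :=
        absoluteGaloisGroup_compactSpace _
      galoisCohomology.localization (mu K (p ^ (m + 1))) (Sum.inl w) 2 c₁ = 0 := fun w hw => by
    haveI : CompactSpace (absoluteGaloisGroup (Place.Completion (K := K) (Sum.inl w))) :=
      absoluteGaloisGroup_compactSpace _
    rw [hc₁, map_sub, hinfw w hw, sub_self]
  -- enlarge `S` to `T = S ∪ Sinf`
  set T : Finset (Place K) := S ∪ Sinf with hTdef
  have hcsum : ∑ v ∈ S, LocalInvariants.canonical K (p ^ (m + 1)) v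
      (galoisCohomology.localization (mu K (p ^ (m + 1))) v 2 c) =
      ∑ v ∈ T, LocalInvariants.canonical K (p ^ (m + 1)) v
        (galoisCohomology.localization (mu K (p ^ (m + 1))) v 2 c) :=
    Finset.sum_subset Finset.subset_union_left fun v _ hv => hS v hv
  rw [hcsum]
  have hsplit : ∀ v : Place K, LocalInvariants.canonical K (p ^ (m + 1)) v
      (galoisCohomology.localization (mu K (p ^ (m + 1))) v 2 c) =
      LocalInvariants.canonical K (p ^ (m + 1)) v (galoisCohomology.localization (mu K (p ^ (m + 1))) v 2 c₁) +
        LocalInvariants.canonical K (p ^ (m + 1)) v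
          (galoisCohomology.localization (mu K (p ^ (m + 1))) v 2 cinf) := fun v => by
    rw [hc₁, map_sub, map_sub, sub_add_cancel]
  rw [Finset.sum_congr rfl fun v _ => hsplit v, Finset.sum_add_distrib, hrec T Finset.subset_union_right,
    add_zero]
  -- the infinite places contribute nothing for `c₁`
  set Tf : Finset (HeightOneSpectrum (𝓞 K)) := T.preimage Sum.inr Sum.inr_injective.injOn with hTf
  have hzero : ∀ x ∈ T, x ∉ Set.range (Sum.inr : HeightOneSpectrum (𝓞 K) → Place K) →
      LocalInvariants.canonical K (p ^ (m + 1)) x (galoisCohomology.localization (mu K (p ^ (m + 1))) x 2 c₁) = 0 := by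
    intro x _ hx
    rcases x with w | v
    · rcases w.isReal_or_isComplex with hw | hw
      · rw [hreal₁ w hw, map_zero]
      · exact LocalInvariants.canonical_inl_eq_zero_of_isComplex hw _
    · exact absurd ⟨v, rfl⟩ hx
  rw [← Finset.sum_preimage Sum.inr T Sum.inr_injective.injOn _ hzero]
  -- the finite places: the law for real-vanishing classes
  refine sum_localInvariantMap_localization_eq_zero_of_forall_isReal K p m c₁ Tf (fun v hv => ?_) hreal₁
  have hv' : (Sum.inr v : Place K) ∉ T := by rwa [Finset.mem_preimage] at hv
  rw [hTdef, Finset.notMem_union] at hv'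
  rw [← LocalInvariants.canonical_inr, hc₁, map_sub, map_sub, hS _ hv'.1, hsupp _ hv'.2, sub_zero]

/-! ### §3. All levels, and the named fact -/

/-- **`(LocalInvariants.canonical K n).SumInvLocalizationEqZero` for every number field `K` and every
`n ≥ 1`**: Tate's reciprocity law `∑_v inv_v (loc_v c) = 0` on `H²(Γ_K, μₙ) = Br(K)[n]` for THE
invariant maps (primary reduction `sumInvLocalizationEqZero_canonical_of_primePow_of_numberField` + the
prime-power case). [cite: CasselsFrohlichANT1967, Ch. VII §11] [cite: MilneADT2006, Ch. I, Thm. 4.10(b)] -/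
theorem sumInvLocalizationEqZero_canonical_of_numberField (n : ℕ) [NeZero n] :
    (LocalInvariants.canonical K n).SumInvLocalizationEqZero := by
  refine sumInvLocalizationEqZero_canonical_of_primePow_of_numberField (fun q _ hq => ?_) n
  obtain ⟨p, k, hpq, hk, rfl⟩ := hq
  haveI : Fact p.Prime := ⟨Nat.prime_iff.mpr hpq⟩
  obtain ⟨m, rfl⟩ : ∃ m, k = m + 1 := ⟨k - 1, by omega⟩
  exact sumInvLocalizationEqZero_canonical_primePow_of_numberField K p m

/-- **Poitou–Tate duality, middle of the nine-term sequence as a complex — the named fact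
`poitouTate_sum_localTatePairing_eq_zero K` HOLDS for every number field `K`** (Milne, *ADT* I
Thm. 4.10 (b); Tate, Cassels–Fröhlich VII §11; Harari Thm. 14.11): for every `n ≥ 1` THE family of local
invariant maps is a local Tate duality at the finite places and the local Tate pairings of global classes
sum to zero — `poitouTate_sum_localTatePairing_eq_zero_of_canonical` fed with
`sumInvLocalizationEqZero_canonical_of_numberField`.  Discharges the hypothesis `(hPT : …)` of the tree's
consumers over any number field `K : Type`. [cite: MilneADT2006, Ch. I, Thm. 4.10(b)]
[cite: CasselsFrohlichANT1967, Ch. VII §11] -/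
theorem poitouTate_sum_localTatePairing_eq_zero_holds :
    ∀ (F : Type) [Field F] [NumberField F], poitouTate_sum_localTatePairing_eq_zero F :=
  fun F _ _ => poitouTate_sum_localTatePairing_eq_zero_of_canonical fun n _ =>
    sumInvLocalizationEqZero_canonical_of_numberField F n

end Literature.NumberTheory.GaloisCohomology

end
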